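import Summits.CriticalPhenomena.PercolationContinuityZ3.Theorems.PercNearOneGluingNoHeavyPcintMemoryFourRecursion
import Literature.Probability.RandomPlanarGeometry.BDGS2012CountBoundsProofs
import HarnessLib

/-!
# CriticalPhenomena/PercolationContinuityZ3 — Theorems/PercNearOneGluingNoHeavyPcintMemoryFourFisherSykes.lean: the memory-4 growth constant IS the Fisher–Sykes root — `μ_4(d)³ = 2(d−1)μ_4(d)² + 2(d−1)μ_4(d) + 1` — so the bond column's `τ = 4` entry is IDENTIFIED

Lane prim-pcint, STRUCTURE rule; the bond-side companion of …PcintNawMemoryFourExact, on top of the exact recursion of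
…PcintMemoryFourRecursion.  With `f(θ) := θ³ − 2(d−1)θ² − 2(d−1)θ − 1`:

* the SUPER-eigenvector argument: for `θ > 1` with `f(θ) ≤ 0` the vector `((θ+1)/(θ−1), θ, 1)` satisfies `N v ≥ θ v`
  (`N` the recursion matrix), whence `A_n, B_n, C_n ≥ c θ^n v` (`endABC_ge_of_cubic_nonpos`, base `one_le_card_endABC_zero`)
  and **`le_memGrowth_four_of_cubic_nonpos` : `θ ≤ μ_4(d)`** (via `μ_4 = lim c_{n,4}^{1/n}`, `tendsto_memCount_rpow`);
* the SUB-eigenvector argument of the Literature file `SAWFisherSykesBound`, run for `μ_4` (`μ_4^n ≤ c_{n,4} = #memFourWords`):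
  **`memGrowth_four_cubic_le` : `f(μ_4) ≤ 0`**;
* hence **`memGrowth_four_cubic_eq` : `μ_4(d)³ = 2(d−1)μ_4(d)² + 2(d−1)μ_4(d) + 1`** (`d ≥ 2`): the `τ = 4` entry of the
  lane's bond memory column (engines: 2.8311773 / 4.8645365 / 6.8916709 for d = 2, 3, 4) is the Fisher–Sykes root,
  kernel-checked — the bond twin of `NawTail.nawMemGrowth_four_eq`.

HONEST FRAMING: classical (Fisher–Sykes 1959, Madras–Slade (1.2.14)); new to the tree as the EQUALITY for the typed `memGrowth d 4`.
Written by prim-pcint-2 gen 16 (prover-prim-pcint-2-g16-0), 2026-08-24.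
-/

noncomputable section

open Filter Topology
open Literature.Probability.LatticeModels Literature.Probability.Percolation
open Literature.Probability.RandomPlanarGeometry.SAW.Zd (endA endB endC EndTurn EndU card_memFourWords_le_endABC
  card_endA_succ_le card_endB_succ_le card_endC_succ_le BDGS2012_connectiveConstant_bounds_holds connectiveConstant)
open Summit.CriticalPhenomena.PercolationContinuityZ3.Theorems.Pcint

namespace Summit.CriticalPhenomena.PercolationContinuityZ3.Theorems.Pcint.MemoryTail

variable {d : ℕ}

/-! ### The super-eigenvector argument: `θ ≤ μ_4` whenever `f(θ) ≤ 0`, `θ > 1` -/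

/-- All three end classes are non-empty in length `3` (`d ≥ 2`): `(a,a,a) ∈ A_0`, `(a,a,b) ∈ B_0`, `(a,b,−a) ∈ C_0`. [folklore] -/
theorem one_le_card_endABC_zero (hd : 2 ≤ d) :
    1 ≤ (endA d 0).card ∧ 1 ≤ (endB d 0).card ∧ 1 ≤ (endC d 0).card := by
  classical
  obtain ⟨d', rfl⟩ : ∃ d', d = d' + 2 := ⟨d - 2, by omega⟩
  let e0 : Fin (d' + 2) := ⟨0, by omega⟩
  let e1 : Fin (d' + 2) := ⟨1, by omega⟩
  have hne : e0 ≠ e1 := by simp [e0, e1]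
  refine ⟨Finset.one_le_card.2 ⟨fun _ => (e0, true), ?_⟩,
    Finset.one_le_card.2 ⟨fun i => if i.val ≤ 1 then (e0, true) else (e1, true), ?_⟩,
    Finset.one_le_card.2 ⟨fun i => if i.val = 0 then (e0, true) else if i.val = 1 then (e1, true) else (e0, false), ?_⟩⟩
  · simp only [endA, Finset.mem_filter, mem_memFourWords, IsMemFour, EndTurn]
    refine ⟨⟨fun k hk h => by simp [srev] at h, fun k hk => by omega⟩, by simp⟩
  · simp only [endB, Finset.mem_filter, mem_memFourWords, IsMemFour, EndTurn, EndU]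
    refine ⟨⟨fun k hk h => ?_, fun k hk => by omega⟩, ?_, ?_⟩
    · have : k ≤ 1 := by omega
      interval_cases k <;> simp [srev] at h
    · simp [hne.symm]
    · simp
  · simp only [endC, Finset.mem_filter, mem_memFourWords, IsMemFour, EndU]
    refine ⟨⟨fun k hk h => ?_, fun k hk => by omega⟩, ?_⟩
    · have : k ≤ 1 := by omega
      interval_cases k <;> simp [srev] at h
      exact hne h
    · refine ⟨by simp [hne.symm], by simp [srev]⟩

/-- **Lower geometric bounds from the exact recursion**: if `θ > 1` and `θ³ ≤ k θ² + k θ + 1` (`k = 2d−2`) then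
`A_n ≥ c θ^n (θ+1)/(θ−1)`, `B_n ≥ c θ^n θ`, `C_n ≥ c θ^n` for some `c > 0` (the vector `((θ+1)/(θ−1), θ, 1)` is a
SUPER-eigenvector of the recursion matrix). [cite: FisherSykes1959, Appendix A (A.2)–(A.9)] -/
theorem endABC_ge_of_cubic_nonpos (hd : 2 ≤ d) {θ : ℝ} (hθ : 1 < θ)
    (hp : θ ^ 3 ≤ (2 * d - 2) * θ ^ 2 + (2 * d - 2) * θ + 1) :
    ∃ c : ℝ, 0 < c ∧ ∀ n : ℕ, c * θ ^ n * ((θ + 1) / (θ - 1)) ≤ (endA d n).card ∧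
      c * θ ^ n * θ ≤ (endB d n).card ∧ c * θ ^ n ≤ (endC d n).card := by
  have hd' : (2 : ℝ) ≤ d := by exact_mod_cast hd
  have hθ1 : 0 < θ - 1 := by linarith
  have hθ0 : 0 < θ := by linarith
  set vA : ℝ := (θ + 1) / (θ - 1) with hvA
  have hvApos : 0 < vA := div_pos (by linarith) hθ1
  -- the three (in)equalities of the super-eigenvector
  have hrowA : vA + θ + 1 = θ * vA := by rw [hvA]; field_simp; ring
  have hrowB : θ * θ ≤ (2 * d - 2) * vA + (2 * d - 3) * θ + (2 * d - 3) * 1 := by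
    rw [hvA, ← sub_nonneg]
    have h2 : (2 * (d : ℝ) - 2) * ((θ + 1) / (θ - 1)) + (2 * d - 3) * θ + (2 * d - 3) * 1 - θ * θ =
        ((2 * d - 2) * (θ + 1) + ((2 * d - 3) * θ + (2 * d - 3) - θ * θ) * (θ - 1)) / (θ - 1) := by
      field_simp
      ring
    rw [h2]
    exact div_nonneg (by nlinarith [hp]) hθ1.le
  obtain ⟨hA0, hB0, hC0⟩ := one_le_card_endABC_zero hd
  refine ⟨min (min (1 / vA) (1 / θ)) 1, lt_min (lt_min (by positivity) (by positivity)) one_pos, fun n => ?_⟩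
  set c : ℝ := min (min (1 / vA) (1 / θ)) 1 with hc
  have hc0 : 0 < c := lt_min (lt_min (by positivity) (by positivity)) one_pos
  have hcA : c * vA ≤ 1 := by
    have : c ≤ 1 / vA := (min_le_left _ _).trans (min_le_left _ _)
    calc c * vA ≤ 1 / vA * vA := by gcongr
      _ = 1 := one_div_mul_cancel hvApos.ne'
  have hcB : c * θ ≤ 1 := by
    have : c ≤ 1 / θ := (min_le_left _ _).trans (min_le_right _ _)
    calc c * θ ≤ 1 / θ * θ := by gcongr
      _ = 1 := one_div_mul_cancel hθ0.ne'
  have hcC : c ≤ 1 := min_le_right _ _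
  induction n with
  | zero =>
    have hA' : (1 : ℝ) ≤ (endA d 0).card := by exact_mod_cast hA0
    have hB' : (1 : ℝ) ≤ (endB d 0).card := by exact_mod_cast hB0
    have hC' : (1 : ℝ) ≤ (endC d 0).card := by exact_mod_cast hC0
    simp only [pow_zero, mul_one]
    exact ⟨by linarith, by linarith, by linarith⟩
  | succ n ih =>
    obtain ⟨iA, iB, iC⟩ := ih
    have hArec : ((endA d n).card : ℝ) + (endB d n).card + (endC d n).card ≤ (endA d (n + 1)).card := by
      have := card_memFourWords_le_card_endA_succ d n
      rw [← card_endABC_eq] at this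
      exact_mod_cast this
    have hCrec : ((endB d n).card : ℝ) ≤ (endC d (n + 1)).card := by exact_mod_cast card_endB_le_card_endC_succ d n
    have hBrec : (2 * (d : ℝ) - 2) * (endA d n).card + (2 * (d : ℝ) - 3) * ((endB d n).card + (endC d n).card) ≤
        (endB d (n + 1)).card := by
      have := le_card_endB_succ d n
      have h' : (((2 * d - 2) * (endA d n).card + (2 * d - 3) * ((endB d n).card + (endC d n).card) : ℕ) : ℝ) ≤
          (endB d (n + 1)).card := by exact_mod_cast this
      rw [Nat.cast_add, Nat.cast_mul, Nat.cast_mul, Nat.cast_sub (by omega), Nat.cast_sub (by omega)] at h'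
      push_cast at h'
      exact h'
    have hpow : 0 ≤ c * θ ^ n := by positivity
    have h22 : (0 : ℝ) ≤ 2 * d - 2 := by linarith
    have h23 : (0 : ℝ) ≤ 2 * d - 3 := by linarith
    refine ⟨?_, ?_, ?_⟩
    · calc c * θ ^ (n + 1) * vA = c * θ ^ n * (θ * vA) := by ring
        _ = c * θ ^ n * vA + c * θ ^ n * θ + c * θ ^ n := by rw [← hrowA]; ring
        _ ≤ _ := by linarith
    · calc c * θ ^ (n + 1) * θ = c * θ ^ n * (θ * θ) := by ring
        _ ≤ c * θ ^ n * ((2 * d - 2) * vA + (2 * d - 3) * θ + (2 * d - 3) * 1) :=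
            mul_le_mul_of_nonneg_left hrowB hpow
        _ = (2 * d - 2) * (c * θ ^ n * vA) + (2 * d - 3) * (c * θ ^ n * θ + c * θ ^ n) := by ring
        _ ≤ (2 * (d : ℝ) - 2) * (endA d n).card + (2 * (d : ℝ) - 3) * ((endB d n).card + (endC d n).card) := by
            gcongr
        _ ≤ _ := hBrec
    · calc c * θ ^ (n + 1) = c * θ ^ n * θ := by ring
        _ ≤ (endB d n).card := iB
        _ ≤ _ := hCrec

/-- **`θ ≤ μ_4(d)` whenever `θ > 1` and `θ³ ≤ 2(d−1)θ² + 2(d−1)θ + 1`** (`d ≥ 2`): `c_{n+3,4} = A_n + B_n + C_n ≥ c θ^n`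
and `μ_4 = lim c_{n,4}^{1/n}`. [cite: FisherSykes1959, Appendix A (A.6)–(A.9)] -/
theorem le_memGrowth_four_of_cubic_nonpos (hd : 2 ≤ d) {θ : ℝ} (hθ : 1 < θ)
    (hp : θ ^ 3 ≤ (2 * d - 2) * θ ^ 2 + (2 * d - 2) * θ + 1) : θ ≤ memGrowth d 4 := by
  haveI : NeZero d := ⟨by omega⟩
  obtain ⟨c, hc0, hcn⟩ := endABC_ge_of_cubic_nonpos hd hθ hp
  have hθ0 : 0 < θ := by linarith
  -- c θ^n ≤ c_{n+3,4}
  have hlow : ∀ n : ℕ, c * θ ^ n ≤ (memCount d 4 (n + 3) : ℝ) := fun n => by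
    obtain ⟨-, -, hC⟩ := hcn n
    rw [memCount_four_eq, ← card_endABC_eq]
    push_cast
    have hA : (0 : ℝ) ≤ (endA d n).card := Nat.cast_nonneg _
    have hB : (0 : ℝ) ≤ (endB d n).card := Nat.cast_nonneg _
    linarith
  -- a_n = (c θ^n)^{1/(n+3)} → θ
  have ha : Tendsto (fun n : ℕ => (c * θ ^ n) ^ (1 / ((n : ℝ) + 3))) atTop (𝓝 θ) := by
    have h0 : ContinuousAt (fun x : ℝ => (c / θ ^ 3) ^ x) 0 := Real.continuousAt_const_rpow (by positivity)
    have h1 : Tendsto (fun n : ℕ => 1 / ((n : ℝ) + 3)) atTop (𝓝 0) := by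
      have h2 := (tendsto_one_div_add_atTop_nhds_zero_nat (𝕜 := ℝ)).comp (tendsto_add_atTop_nat 2)
      refine h2.congr fun n => ?_
      simp only [Function.comp_apply]; push_cast; ring
    have h3 : Tendsto (fun n : ℕ => (c / θ ^ 3) ^ (1 / ((n : ℝ) + 3)) * θ) atTop (𝓝 θ) := by
      have := (h0.tendsto.comp h1).mul_const θ
      simpa [Real.rpow_zero, Function.comp_def] using this
    refine h3.congr fun n => ?_
    have hn3 : (0 : ℝ) < (n : ℝ) + 3 := by positivity
    have hKl : c * θ ^ n = (c / θ ^ 3) * θ ^ (n + 3) := by field_simp; ring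
    rw [hKl, Real.mul_rpow (by positivity) (by positivity)]
    congr 1
    rw [← Real.rpow_natCast θ (n + 3), ← Real.rpow_mul hθ0.le]
    push_cast
    rw [mul_one_div_cancel hn3.ne', Real.rpow_one]
  have hb : Tendsto (fun n : ℕ => (memCount d 4 (n + 3) : ℝ) ^ (1 / ((n : ℝ) + 3))) atTop (𝓝 (memGrowth d 4)) := by
    have := (tendsto_memCount_rpow (d := d) 4).comp (tendsto_add_atTop_nat 3)
    refine this.congr fun n => ?_
    simp only [Function.comp_apply]; push_cast; rfl
  refine le_of_tendsto_of_tendsto' ha hb fun n => ?_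
  exact Real.rpow_le_rpow (by positivity) (hlow n) (by positivity)

/-! ### The sub-eigenvector argument for `μ_4` (the Literature file's argument, run for `memGrowth d 4`) -/

/-- The vector `((θ+1)/(θ−1), θ, 1)` is a SUB-eigenvector (`N v ≤ θ v`) when `θ > 1` and `f(θ) ≥ 0`. [folklore] -/
private theorem subeigen' {k θ : ℝ} (hθ : 1 < θ) (hp : 0 ≤ θ ^ 3 - k * θ ^ 2 - k * θ - 1) :
    (θ + 1) / (θ - 1) + θ + 1 ≤ θ * ((θ + 1) / (θ - 1)) ∧
      k * ((θ + 1) / (θ - 1)) + (k - 1) * θ + (k - 1) * 1 ≤ θ * θ ∧ θ ≤ θ * 1 := by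
  have h1 : 0 < θ - 1 := by linarith
  refine ⟨?_, ?_, by linarith⟩
  · rw [div_add' _ _ _ h1.ne', div_add' _ _ _ h1.ne', mul_div_assoc', div_le_div_iff_of_pos_right h1]
    nlinarith
  · have : k * ((θ + 1) / (θ - 1)) = k * (θ + 1) / (θ - 1) := by ring
    rw [this, div_add' _ _ _ h1.ne', div_add' _ _ _ h1.ne', div_le_iff₀ h1]
    nlinarith

/-- **`f(μ_4) ≤ 0`**: `μ_4(d)³ ≤ 2(d−1)μ_4² + 2(d−1)μ_4 + 1` (`d ≥ 2`) — the Fisher–Sykes argument of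
`SAWFisherSykesBound` with `μ_4^n ≤ c_{n,4} = #memFourWords` in place of `μ^n ≤ c_n ≤ #memFourWords`.
[cite: FisherSykes1959, Appendix A (A.2)–(A.9)] [cite: MadrasSlade1993, §1.2 (1.2.14)] -/
theorem memGrowth_four_cubic_le (hd : 2 ≤ d) :
    memGrowth d 4 ^ 3 ≤ 2 * ((d : ℝ) - 1) * memGrowth d 4 ^ 2 + 2 * ((d : ℝ) - 1) * memGrowth d 4 + 1 := by
  classical
  haveI : NeZero d := ⟨by omega⟩
  set μ := memGrowth d 4 with hμdef
  set k : ℝ := 2 * (d : ℝ) - 2 with hkdef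
  have hd' : (2 : ℝ) ≤ d := by exact_mod_cast hd
  have hμ2 : (2 : ℝ) ≤ μ :=
    le_trans (le_trans hd' (BDGS2012_connectiveConstant_bounds_holds d (by omega)).1) (connectiveConstant_le_memGrowth 4)
  set p : ℝ → ℝ := fun θ => θ ^ 3 - k * θ ^ 2 - k * θ - 1 with hpdef
  by_contra hcon
  have hpμ : 0 < p μ := by
    have : ¬ μ ^ 3 ≤ 2 * ((d : ℝ) - 1) * μ ^ 2 + 2 * ((d : ℝ) - 1) * μ + 1 := hcon
    simp only [hpdef, hkdef]; linarith [lt_of_not_ge this]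
  have hcont : Continuous p := by simp only [hpdef]; fun_prop
  obtain ⟨δ, hδpos, hδ⟩ : ∃ δ > 0, ∀ θ, |θ - μ| < δ → 0 < p θ := by
    have hopen : IsOpen {θ : ℝ | 0 < p θ} := isOpen_lt continuous_const hcont
    obtain ⟨δ, hδpos, hball⟩ := Metric.isOpen_iff.1 hopen μ hpμ
    exact ⟨δ, hδpos, fun θ hθ => hball (by rwa [Metric.mem_ball, Real.dist_eq])⟩
  set θ : ℝ := μ - min (δ / 2) (1 / 2) with hθdef
  have hθμ : θ < μ := by
    have : 0 < min (δ / 2) (1 / 2) := lt_min (by linarith) (by norm_num); linarith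
  have hθ1 : 1 < θ := by have := min_le_right (δ / 2) (1 / 2 : ℝ); linarith
  have hpθ : 0 ≤ p θ := by
    refine (hδ θ ?_).le
    rw [hθdef, show μ - min (δ / 2) (1 / 2) - μ = -min (δ / 2) (1 / 2) by ring, abs_neg,
      abs_of_pos (lt_min (by linarith) (by norm_num))]
    exact lt_of_le_of_lt (min_le_left _ _) (by linarith)
  obtain ⟨hvA, hvB, hvC⟩ := subeigen' (k := k) hθ1 (by simpa [hpdef] using hpθ)
  set vA : ℝ := (θ + 1) / (θ - 1) with hvAdef
  have hvApos : 1 ≤ vA := by rw [hvAdef, le_div_iff₀ (by linarith)]; linarith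
  have hθpos : 0 < θ := by linarith
  set M0 : ℝ := (2 * (d : ℝ)) ^ 3 with hM0
  have hbase : ∀ n, ((memFourWords d (n + 3)).card : ℝ) ≤ M0 * (2 * d) ^ n := fun n => by
    have := card_memFourWords_le_pow d (n + 3)
    have h' : ((memFourWords d (n + 3)).card : ℝ) ≤ ((2 * d : ℕ) : ℝ) ^ (n + 3) := by exact_mod_cast this
    calc ((memFourWords d (n + 3)).card : ℝ) ≤ ((2 * d : ℕ) : ℝ) ^ (n + 3) := h'
      _ = M0 * (2 * d) ^ n := by rw [hM0]; push_cast; ring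
  have hk1 : (1 : ℝ) ≤ k := by rw [hkdef]; linarith
  have hind : ∀ n, ((endA d n).card : ℝ) ≤ M0 * θ ^ n * vA ∧ ((endB d n).card : ℝ) ≤ M0 * θ ^ n * θ ∧
      ((endC d n).card : ℝ) ≤ M0 * θ ^ n * 1 := by
    intro n
    induction n with
    | zero =>
      have hall : ∀ S : Finset (Fin 3 → Fin d × Bool), S ⊆ memFourWords d 3 → (S.card : ℝ) ≤ M0 := by
        intro S hS
        have h1 : (S.card : ℝ) ≤ (memFourWords d 3).card := by exact_mod_cast Finset.card_le_card hS
        have h2 := hbase 0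
        rw [pow_zero, mul_one] at h2
        exact h1.trans h2
      have hM0nn : 0 ≤ M0 := by rw [hM0]; positivity
      refine ⟨?_, ?_, ?_⟩
      · have := hall (endA d 0) (Finset.filter_subset _ _)
        rw [pow_zero, mul_one]; nlinarith
      · have := hall (endB d 0) (Finset.filter_subset _ _)
        rw [pow_zero, mul_one]; nlinarith
      · have := hall (endC d 0) (Finset.filter_subset _ _)
        rw [pow_zero, mul_one, mul_one]; exact this
    | succ n ih =>
      obtain ⟨iA, iB, iC⟩ := ih
      have hsum : ((memFourWords d (n + 3)).card : ℝ) ≤ M0 * θ ^ n * (vA + θ + 1) := by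
        have := card_memFourWords_le_endABC d n
        have h' : ((memFourWords d (n + 3)).card : ℝ) ≤
            (endA d n).card + (endB d n).card + (endC d n).card := by exact_mod_cast this
        linarith
      have hθn : 0 ≤ M0 * θ ^ n := by rw [hM0]; positivity
      refine ⟨?_, ?_, ?_⟩
      · have h1 : ((endA d (n + 1)).card : ℝ) ≤ (memFourWords d (n + 3)).card := by
          exact_mod_cast card_endA_succ_le d n
        calc ((endA d (n + 1)).card : ℝ) ≤ M0 * θ ^ n * (vA + θ + 1) := h1.trans hsum
          _ ≤ M0 * θ ^ n * (θ * vA) := mul_le_mul_of_nonneg_left hvA hθn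
          _ = M0 * θ ^ (n + 1) * vA := by ring
      · have h1 : ((endB d (n + 1)).card : ℝ) ≤
            (2 * d - 2 : ℕ) * (endA d n).card + (2 * d - 3 : ℕ) * ((endB d n).card + (endC d n).card) := by
          exact_mod_cast card_endB_succ_le d n
        have hc1 : ((2 * d - 2 : ℕ) : ℝ) = k := by
          rw [hkdef, Nat.cast_sub (by omega)]; push_cast; ring
        have hc2 : ((2 * d - 3 : ℕ) : ℝ) = k - 1 := by
          rw [hkdef, Nat.cast_sub (by omega)]; push_cast; ring
        rw [hc1, hc2] at h1
        have hk0 : 0 ≤ k - 1 := by linarith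
        calc ((endB d (n + 1)).card : ℝ) ≤ k * (endA d n).card + (k - 1) * ((endB d n).card + (endC d n).card) := h1
          _ ≤ k * (M0 * θ ^ n * vA) + (k - 1) * (M0 * θ ^ n * θ + M0 * θ ^ n * 1) := by
              gcongr
          _ = M0 * θ ^ n * (k * vA + (k - 1) * θ + (k - 1) * 1) := by ring
          _ ≤ M0 * θ ^ n * (θ * θ) := mul_le_mul_of_nonneg_left hvB hθn
          _ = M0 * θ ^ (n + 1) * θ := by ring
      · have h1 : ((endC d (n + 1)).card : ℝ) ≤ (endB d n).card := by exact_mod_cast card_endC_succ_le d n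
        calc ((endC d (n + 1)).card : ℝ) ≤ M0 * θ ^ n * θ := h1.trans iB
          _ = M0 * θ ^ (n + 1) * 1 := by ring
  -- total count and the contradiction with `μ_4^n ≤ c_{n,4}`
  have htot : ∀ n, μ ^ (n + 3) ≤ M0 * (vA + θ + 1) * θ ^ n := fun n => by
    obtain ⟨iA, iB, iC⟩ := hind n
    have h1 : μ ^ (n + 3) ≤ memCount d 4 (n + 3) := pow_memGrowth_le_memCount d 4 (n + 2)
    have h2 : (memCount d 4 (n + 3) : ℝ) = (memFourWords d (n + 3)).card := by rw [memCount_four_eq]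
    have h3' : ((memFourWords d (n + 3)).card : ℝ) ≤ (endA d n).card + (endB d n).card + (endC d n).card := by
      exact_mod_cast card_memFourWords_le_endABC d n
    calc μ ^ (n + 3) ≤ (memCount d 4 (n + 3) : ℝ) := h1
      _ = _ := h2
      _ ≤ _ := h3'
      _ ≤ M0 * θ ^ n * vA + M0 * θ ^ n * θ + M0 * θ ^ n * 1 := by linarith
      _ = M0 * (vA + θ + 1) * θ ^ n := by ring
  have hK : 0 < M0 * (vA + θ + 1) := by rw [hM0]; positivity
  have hr : 1 < μ / θ := (one_lt_div hθpos).2 hθμ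
  have hbd : ∀ n : ℕ, (μ / θ) ^ n ≤ M0 * (vA + θ + 1) / μ ^ 3 := fun n => by
    rw [div_pow, div_le_div_iff₀ (pow_pos hθpos n) (by positivity)]
    calc μ ^ n * μ ^ 3 = μ ^ (n + 3) := by ring
      _ ≤ M0 * (vA + θ + 1) * θ ^ n := htot n
  obtain ⟨n, hn⟩ := ((tendsto_pow_atTop_atTop_of_one_lt hr).eventually
    (eventually_gt_atTop (M0 * (vA + θ + 1) / μ ^ 3))).exists
  exact absurd (hbd n) (not_le.2 hn)

/-- **`μ_4(d)³ = 2(d−1)μ_4(d)² + 2(d−1)μ_4(d) + 1`**: the memory-4 growth constant IS the Fisher–Sykes root (`d ≥ 2`;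
`μ_4(2) = 2.8312`, `μ_4(3) = 4.8645`, `μ_4(4) = 6.8917`) — the `τ = 4` entry of the bond memory column of STRUCTURE §1,
IDENTIFIED in Lean.  (`≤`: `memGrowth_four_cubic_le`; `≥`: if `f(μ_4) < 0` then `f < 0` slightly above `μ_4`, and
`le_memGrowth_four_of_cubic_nonpos` puts that larger `θ` below `μ_4`.) [cite: FisherSykes1959, Appendix A (A.6)–(A.9)]
[cite: MadrasSlade1993, §1.2 (1.2.14)] -/
theorem memGrowth_four_cubic_eq (hd : 2 ≤ d) :
    memGrowth d 4 ^ 3 = 2 * ((d : ℝ) - 1) * memGrowth d 4 ^ 2 + 2 * ((d : ℝ) - 1) * memGrowth d 4 + 1 := by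
  haveI : NeZero d := ⟨by omega⟩
  refine le_antisymm (memGrowth_four_cubic_le hd) ?_
  set μ := memGrowth d 4 with hμdef
  have hd' : (2 : ℝ) ≤ d := by exact_mod_cast hd
  have hμ2 : (2 : ℝ) ≤ μ :=
    le_trans (le_trans hd' (BDGS2012_connectiveConstant_bounds_holds d (by omega)).1) (connectiveConstant_le_memGrowth 4)
  set p : ℝ → ℝ := fun θ => θ ^ 3 - (2 * d - 2) * θ ^ 2 - (2 * d - 2) * θ - 1 with hpdef
  by_contra hcon
  have hpμ : p μ < 0 := by
    have : ¬ 2 * ((d : ℝ) - 1) * μ ^ 2 + 2 * ((d : ℝ) - 1) * μ + 1 ≤ μ ^ 3 := hcon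
    simp only [hpdef]; linarith [lt_of_not_ge this]
  have hcont : Continuous p := by simp only [hpdef]; fun_prop
  obtain ⟨δ, hδpos, hδ⟩ : ∃ δ > 0, ∀ θ, |θ - μ| < δ → p θ < 0 := by
    have hopen : IsOpen {θ : ℝ | p θ < 0} := isOpen_lt hcont continuous_const
    obtain ⟨δ, hδpos, hball⟩ := Metric.isOpen_iff.1 hopen μ hpμ
    exact ⟨δ, hδpos, fun θ hθ => hball (by rwa [Metric.mem_ball, Real.dist_eq])⟩
  set θ : ℝ := μ + δ / 2 with hθdef
  have hθ1 : 1 < θ := by rw [hθdef]; linarith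
  have hpθ : p θ < 0 := hδ θ (by rw [hθdef, show μ + δ / 2 - μ = δ / 2 by ring, abs_of_pos (by linarith)]; linarith)
  have hle : θ ≤ μ := le_memGrowth_four_of_cubic_nonpos hd hθ1 (by simp only [hpdef] at hpθ; linarith)
  rw [hθdef] at hle
  linarith

end Summit.CriticalPhenomena.PercolationContinuityZ3.Theorems.Pcint.MemoryTail
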